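import Mathlib.Data.Fin.Embedding
import Literature.Computability.AlgebraicComplexity.PrattTripartitionBoundsProofs
import Literature.Computability.AlgebraicComplexity.PrattBalancedRelabelling
import HarnessLib

/-!
# The quantity Pratt's algorithm tests: tripartitions surviving a relabelling (Thm. 1.9, proof)

Topic `Computability/AlgebraicComplexity`. Fifth instalment (b) of the proof of
`Literature.Computability.AlgebraicComplexity.pratt2024_thm_1_9` (K. Pratt, STOC 2024, Thm. 1.9).
One round of the algorithm of §2, as a mathematical object. Given an instance
`I = (n, 𝓕₀, 𝓕₁, 𝓕₂)` of Balanced Tripartitioning (`TripartitioningInstance`), parameters `k, r`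
with `n ≤ k r`, and a permutation `a` of the padded universe `[3kr]`:

* `padSet n k r i` — the padding block `P_i` added to the sets of family `i` ("Pick any
  equipartition `S₁ ⊔ S₂ ⊔ S₃ = [3n] ∖ [3n₀]` … `𝓕_i := {X ∪ S_i : X ∈ 𝓕_{i0}}`");
  `padFamily I h i` — the padded family, subsets of `Fin (3(kr))`;
* `indicator I h i a d` — the `0/1` input of the evaluation: is the relabelled block union
  `a(blockUnion d)` (`TripartitionIndex.blockUnion`, `d : Fin r → binom([3k],k)`, Pratt's `x ∈ X`,
  from `PrattTripartitionBoundsProofs.lean`) a member of the padded family?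
  ("`𝓕_i' := σ(𝓕_i) ∩ X`", pulled back along `a = σ⁻¹`);
* `relabelledCount I h a = ∑_{d₀,d₁,d₂} T_k^{⊗r}(d₀,d₁,d₂) · 1_{𝓕₀'}(d₀) 1_{𝓕₁'}(d₁) 1_{𝓕₂'}(d₂)`
  — the value of the restricted trilinear form at the indicator vectors, i.e. the number of
  tripartitions of `[3kr]` into members of the relabelled padded families that are balanced in
  every block;
* **`relabelledCount_eq_zero`**: on a NO instance it vanishes for every `a` ("If `{𝓕_i}`
  contained no tripartition, certainly neither will `{𝓕_i'}`");
* **`one_le_relabelledCount`**: on a YES instance with solution `(S₀,S₁,S₂)`, it is `≥ 1` as soon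
  as the solution's labelling `solutionLabelling`, read through `a`, is block-balanced
  (`IsBlockBalanced`, instalment 3b) — the event whose probability instalment 3b bounds below
  (pairwise disjointness of the solution is derived from the cover, `disjoint_iff_union_eq_univ`);
* `solutionLabelling_mem_profileLabellings`: that labelling uses each label `kr` times.

## References

* [Pratt2024SCC] K. Pratt, STOC 2024, arXiv:2311.02774 — §2, proof of Thm. 1.9.
-/

noncomputable section

open scoped BigOperators

namespace Literature.Computability.AlgebraicComplexity

open Finset Equiv FineGrained TripartitionIndex

/-! ## Padding -/

section Padding

variable (n k r : ℕ)

/-- The original universe `[3n]` inside the padded universe `[3kr]` (`n ≤ kr`). [cite: Pratt2024SCC, §2 (proof of Thm. 1.9)] -/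
def embedElt (h : n ≤ k * r) : Fin (3 * n) ↪ Fin (3 * (k * r)) :=
  Fin.castLEEmb (by omega)

/-- The padding block of family `i`: the `kr - n` elements
`3n + i (kr - n), …, 3n + (i+1)(kr - n) - 1` of `[3kr]`. [cite: Pratt2024SCC, §2 (proof of Thm. 1.9)] -/
def padSet (i : Fin 3) : Finset (Fin (3 * (k * r))) :=
  {e | 3 * n + i * (k * r - n) ≤ (e : ℕ) ∧ (e : ℕ) < 3 * n + (i + 1) * (k * r - n)}

variable {n k r}

/-- Membership in a padding block. [folklore] -/
@[simp] theorem mem_padSet {i : Fin 3} {e : Fin (3 * (k * r))} :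
    e ∈ padSet n k r i ↔ 3 * n + i * (k * r - n) ≤ (e : ℕ) ∧ (e : ℕ) < 3 * n + (i + 1) * (k * r - n) := by
  simp [padSet]

/-- Embedded original elements are below `3n`. [folklore] -/
@[simp] theorem coe_embedElt (h : n ≤ k * r) (x : Fin (3 * n)) : (embedElt n k r h x : ℕ) = x := rfl

/-- Original elements are not padding. [folklore] -/
theorem embedElt_not_mem_padSet (h : n ≤ k * r) (x : Fin (3 * n)) (i : Fin 3) :
    embedElt n k r h x ∉ padSet n k r i := by
  simp only [mem_padSet, coe_embedElt, not_and, not_lt]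
  intro h1; have := x.2; omega

/-- Distinct padding blocks are disjoint. [folklore] -/
theorem disjoint_padSet {i i' : Fin 3} (hii' : i ≠ i') : Disjoint (padSet n k r i) (padSet n k r i') := by
  rw [Finset.disjoint_left]
  intro e he he'
  simp only [mem_padSet] at he he'
  have : (i : ℕ) ≠ i' := fun e => hii' (Fin.ext e)
  rcases Nat.lt_or_gt_of_ne this with hlt | hlt
  · have : (i : ℕ) + 1 ≤ i' := hlt
    have := Nat.mul_le_mul_right (k * r - n) this
    omega
  · have : (i' : ℕ) + 1 ≤ i := hlt
    have := Nat.mul_le_mul_right (k * r - n) this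
    omega

/-- A padding block has `kr - n` elements. [folklore] -/
theorem card_padSet (h : n ≤ k * r) (i : Fin 3) : #(padSet n k r i) = k * r - n := by
  -- it is the image of `[kr - n]` under `t ↦ 3n + i(kr-n) + t`
  have hi := i.2
  have hbound : ∀ t, t < k * r - n → 3 * n + i * (k * r - n) + t < 3 * (k * r) := by
    intro t ht
    have : (i : ℕ) * (k * r - n) + t < 3 * (k * r - n) := by
      calc (i : ℕ) * (k * r - n) + t < i * (k * r - n) + (k * r - n) := by omega
        _ = (i + 1) * (k * r - n) := by ring
        _ ≤ 3 * (k * r - n) := Nat.mul_le_mul_right _ (by omega)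
    omega
  let f : Fin (k * r - n) → Fin (3 * (k * r)) := fun t => ⟨3 * n + i * (k * r - n) + t, hbound t t.2⟩
  have hf : Function.Injective f := fun t t' e => by
    simp only [f, Fin.mk.injEq] at e; exact Fin.ext (by omega)
  have : padSet n k r i = Finset.univ.image f := by
    ext e
    simp only [mem_padSet, Finset.mem_image, Finset.mem_univ, true_and, f]
    constructor
    · rintro ⟨h1, h2⟩
      refine ⟨⟨(e : ℕ) - (3 * n + i * (k * r - n)), ?_⟩, Fin.ext ?_⟩
      · have : (e : ℕ) < 3 * n + i * (k * r - n) + (k * r - n) := by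
          have e2 : ((i : ℕ) + 1) * (k * r - n) = i * (k * r - n) + (k * r - n) := by ring
          omega
        omega
      · simp; omega
    · rintro ⟨t, rfl⟩
      have ht := t.2
      have e2 : ((i : ℕ) + 1) * (k * r - n) = i * (k * r - n) + (k * r - n) := by ring
      change 3 * n + i * (k * r - n) ≤ 3 * n + i * (k * r - n) + t ∧
        3 * n + i * (k * r - n) + t < 3 * n + (i + 1) * (k * r - n)
      omega
  rw [this, Finset.card_image_of_injective _ hf, Finset.card_univ, Fintype.card_fin]

/-- Every element of `[3kr]` is original or padding. [folklore] -/
theorem exists_embedElt_or_mem_padSet (h : n ≤ k * r) (e : Fin (3 * (k * r))) :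
    (∃ x, embedElt n k r h x = e) ∨ ∃ i, e ∈ padSet n k r i := by
  by_cases he : (e : ℕ) < 3 * n
  · exact Or.inl ⟨⟨e, he⟩, Fin.ext rfl⟩
  · right
    have he : 3 * n ≤ (e : ℕ) := Nat.le_of_not_lt he
    have hlt := e.2
    have hpos : 0 < k * r - n := by
      by_contra h0
      have : k * r - n = 0 := by omega
      omega
    -- the block index
    set q := ((e : ℕ) - 3 * n) / (k * r - n) with hq
    have hq3 : q < 3 := by
      rw [hq, Nat.div_lt_iff_lt_mul hpos]; omega
    refine ⟨⟨q, hq3⟩, ?_⟩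
    simp only [mem_padSet]
    have h1 := Nat.div_mul_le_self ((e : ℕ) - 3 * n) (k * r - n)
    have h2 := Nat.lt_div_mul_add (a := (e : ℕ) - 3 * n) hpos
    rw [← hq] at h1 h2
    constructor
    · show 3 * n + q * (k * r - n) ≤ (e : ℕ)
      omega
    · show (e : ℕ) < 3 * n + (q + 1) * (k * r - n)
      have : (q + 1) * (k * r - n) = q * (k * r - n) + (k * r - n) := by ring
      omega

end Padding

/-! ## Entries of `T_k^{⊗r}` -/

section Blocks

variable {k r : ℕ}

/-- A nonzero entry of `T_k^{⊗r}` has blockwise pairwise disjoint indices. [cite: Pratt2024SCC, Def. 1.4] -/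
theorem disjoint_of_kroneckerPow_ne_zero {d₀ d₁ d₂ : Fin r → TripartitionIndex k}
    (h : kroneckerPow (tripartitionTensor ℤ k) r d₀ d₁ d₂ ≠ 0) (b : Fin r) :
    Disjoint (d₀ b).1 (d₁ b).1 ∧ Disjoint (d₀ b).1 (d₂ b).1 ∧ Disjoint (d₁ b).1 (d₂ b).1 := by
  by_contra hb
  apply h
  rw [kroneckerPow_apply]
  exact Finset.prod_eq_zero (Finset.mem_univ b) (tripartitionTensor_apply_of_not ℤ k hb)

end Blocks

/-! ## Padded families and the relabelled indicator vectors -/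

section Families

variable {k r : ℕ} (I : TripartitioningInstance) (h : I.n ≤ k * r)

/-- The padded family `𝓕_i := {X ∪ P_i : X ∈ 𝓕_{i0}}` as subsets of `[3kr]`.
[cite: Pratt2024SCC, §2 (proof of Thm. 1.9)] -/
def padFamily (i : Fin 3) : Finset (Finset (Fin (3 * (k * r)))) :=
  ((I.F i).toFinset).image fun S => S.map (embedElt I.n k r h) ∪ padSet I.n k r i

/-- The `0/1` input of the evaluation for family `i` under the relabelling `a`: whether the
relabelled block union `a(blockUnion d)` belongs to the padded family ("`𝓕_i' = σ(𝓕_i) ∩ X`" read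
through `a = σ⁻¹` on Pratt's set `X` of block-balanced sets). [cite: Pratt2024SCC, §2 (proof of Thm. 1.9)] -/
def indicator (i : Fin 3) (a : Fin (3 * (k * r)) → Fin (3 * (k * r)))
    (d : Fin r → TripartitionIndex k) : ℤ :=
  if (blockUnion d).1.image a ∈ padFamily I h i then 1 else 0

/-- **The tested quantity**: the restriction of `T_k^{⊗r}` evaluated at the three indicator
vectors, `∑_{d₀,d₁,d₂} T_k^{⊗r}(d₀,d₁,d₂) 1_{𝓕₀'}(d₀) 1_{𝓕₁'}(d₁) 1_{𝓕₂'}(d₂)` — the number of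
block-balanced tripartitions of `[3kr]` into members of the relabelled padded families.
[cite: Pratt2024SCC, §2 (proof of Thm. 1.9)] -/
def relabelledCount (a : Fin (3 * (k * r)) → Fin (3 * (k * r))) : ℤ :=
  ∑ d₀ : Fin r → TripartitionIndex k, ∑ d₁ : Fin r → TripartitionIndex k,
    ∑ d₂ : Fin r → TripartitionIndex k,
      kroneckerPow (tripartitionTensor ℤ k) r d₀ d₁ d₂ *
        (indicator I h 0 a d₀ * indicator I h 1 a d₁ * indicator I h 2 a d₂)

variable {I h}

/-- Indicators are `0` or `1`. [folklore] -/
theorem indicator_nonneg (i : Fin 3) (a : Fin (3 * (k * r)) → Fin (3 * (k * r)))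
    (d : Fin r → TripartitionIndex k) : 0 ≤ indicator I h i a d := by
  unfold indicator; split_ifs <;> norm_num

/-- Each term of `relabelledCount` is nonnegative. [folklore] -/
theorem term_nonneg (a : Fin (3 * (k * r)) → Fin (3 * (k * r))) (d₀ d₁ d₂ : Fin r → TripartitionIndex k) :
    0 ≤ kroneckerPow (tripartitionTensor ℤ k) r d₀ d₁ d₂ *
        (indicator I h 0 a d₀ * indicator I h 1 a d₁ * indicator I h 2 a d₂) := by
  refine mul_nonneg ?_ (mul_nonneg (mul_nonneg (indicator_nonneg _ _ _) (indicator_nonneg _ _ _))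
    (indicator_nonneg _ _ _))
  rw [kroneckerPow_apply]
  exact Finset.prod_nonneg fun i _ => by rw [tripartitionTensor_apply]; split_ifs <;> norm_num

/-- Members of the padded family `i` are `S ∪ P_i` with `S ∈ 𝓕_i` (embedded). [folklore] -/
theorem mem_padFamily {i : Fin 3} {Y : Finset (Fin (3 * (k * r)))} :
    Y ∈ padFamily I h i ↔ ∃ S ∈ I.F i, Y = S.map (embedElt I.n k r h) ∪ padSet I.n k r i := by
  simp only [padFamily, Finset.mem_image, List.mem_toFinset]
  constructor
  · rintro ⟨S, hS, rfl⟩; exact ⟨S, hS, rfl⟩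
  · rintro ⟨S, hS, rfl⟩; exact ⟨S, hS, rfl⟩

/-- Disjoint padded members of distinct families have disjoint original parts. [folklore] -/
theorem disjoint_of_disjoint_pad {S S' : Finset (Fin (3 * I.n))} {i i' : Fin 3}
    (hd : Disjoint (S.map (embedElt I.n k r h) ∪ padSet I.n k r i)
      (S'.map (embedElt I.n k r h) ∪ padSet I.n k r i')) : Disjoint S S' := by
  rw [Finset.disjoint_union_left, Finset.disjoint_union_right] at hd
  have := hd.1.1
  rwa [Finset.disjoint_map] at this

/-- **NO instances are never accepted**: if `I` has no tripartition, `relabelledCount I h a = 0`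
for every injective relabelling `a` ("If `{𝓕_i}` contained no tripartition, certainly neither will
`{𝓕_i'}`"). [cite: Pratt2024SCC, §2 (proof of Thm. 1.9)] -/
theorem relabelledCount_eq_zero (hno : ¬ I.HasTripartition) {a : Fin (3 * (k * r)) → Fin (3 * (k * r))}
    (ha : Function.Injective a) : relabelledCount I h a = 0 := by
  classical
  unfold relabelledCount
  refine Finset.sum_eq_zero fun d₀ _ => Finset.sum_eq_zero fun d₁ _ => Finset.sum_eq_zero fun d₂ _ => ?_
  -- if the tensor entry is nonzero the block unions are pairwise disjoint
  by_cases hT : kroneckerPow (tripartitionTensor ℤ k) r d₀ d₁ d₂ = 0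
  · rw [hT, zero_mul]
  have hdis : Disjoint (blockUnion d₀).1 (blockUnion d₁).1 ∧ Disjoint (blockUnion d₀).1 (blockUnion d₂).1 ∧
      Disjoint (blockUnion d₁).1 (blockUnion d₂).1 :=
    ⟨(disjoint_blockUnion d₀ d₁).2 fun b => (disjoint_of_kroneckerPow_ne_zero hT b).1,
      (disjoint_blockUnion d₀ d₂).2 fun b => (disjoint_of_kroneckerPow_ne_zero hT b).2.1,
      (disjoint_blockUnion d₁ d₂).2 fun b => (disjoint_of_kroneckerPow_ne_zero hT b).2.2⟩
  -- and if moreover all three indicators are `1`, we get a tripartition of `I`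
  unfold indicator
  split_ifs with h0 h1 h2 <;> simp only [mul_zero, mul_one]
  exfalso
  obtain ⟨S₀, hS₀, e₀⟩ := mem_padFamily.1 h0
  obtain ⟨S₁, hS₁, e₁⟩ := mem_padFamily.1 h1
  obtain ⟨S₂, hS₂, e₂⟩ := mem_padFamily.1 h2
  have himg : ∀ {A B : Finset (Fin (3 * (k * r)))}, Disjoint A B →
      Disjoint (A.image a) (B.image a) := fun hAB => (Finset.disjoint_image ha).2 hAB
  have d01 : Disjoint S₀ S₁ := by
    refine disjoint_of_disjoint_pad (h := h) (i := 0) (i' := 1) ?_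
    rw [← e₀, ← e₁]; exact himg hdis.1
  have d02 : Disjoint S₀ S₂ := by
    refine disjoint_of_disjoint_pad (h := h) (i := 0) (i' := 2) ?_
    rw [← e₀, ← e₂]; exact himg hdis.2.1
  have d12 : Disjoint S₁ S₂ := by
    refine disjoint_of_disjoint_pad (h := h) (i := 1) (i' := 2) ?_
    rw [← e₁, ← e₂]; exact himg hdis.2.2
  apply hno
  refine ⟨S₀, hS₀, S₁, hS₁, S₂, hS₂, ?_⟩
  have := (TripartitionIndex.disjoint_iff_union_eq_univ (k := I.n) ⟨S₀, I.card_eq 0 S₀ hS₀⟩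
    ⟨S₁, I.card_eq 1 S₁ hS₁⟩ ⟨S₂, I.card_eq 2 S₂ hS₂⟩).1 ⟨d01, d02, d12⟩
  exact this

end Families

/-! ## YES instances: the solution's labelling -/

section Solution

variable {k r : ℕ} {I : TripartitioningInstance} (h : I.n ≤ k * r)
variable (S : Fin 3 → Finset (Fin (3 * I.n)))

/-- The padded solution sets `Y_i = S_i ∪ P_i` of a solution `(S₀, S₁, S₂)`. [cite: Pratt2024SCC, §2 (proof of Thm. 1.9)] -/
def padSol (i : Fin 3) : Finset (Fin (3 * (k * r))) :=
  (S i).map (embedElt I.n k r h) ∪ padSet I.n k r i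

/-- The labelling of `[3kr]` by the padded solution: label `i` on `Y_i` (first match). [cite: Pratt2024SCC, §2 (proof of Thm. 1.9)] -/
def solutionLabelling : Fin (3 * (k * r)) → Fin 3 := fun e =>
  if e ∈ padSol h S 0 then 0 else if e ∈ padSol h S 1 then 1 else 2

variable {h S}

/-- For a genuine solution (pairwise disjoint, covering), label `i` is carried exactly by `Y_i`.
[folklore] -/
theorem solutionLabelling_eq_iff (hdis : Disjoint (S 0) (S 1) ∧ Disjoint (S 0) (S 2) ∧ Disjoint (S 1) (S 2))
    (hcov : S 0 ∪ S 1 ∪ S 2 = Finset.univ) (e : Fin (3 * (k * r))) (i : Fin 3) :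
    solutionLabelling h S e = i ↔ e ∈ padSol h S i := by
  classical
  -- the padded sets are pairwise disjoint and cover
  have hpd : ∀ {i i' : Fin 3}, i ≠ i' → Disjoint (padSol h S i) (padSol h S i') := by
    intro i i' hii'
    simp only [padSol, Finset.disjoint_union_left, Finset.disjoint_union_right, Finset.disjoint_map]
    have h3 : ∀ i i' : Fin 3, i ≠ i' → Disjoint (S i) (S i') := by
      intro i i' hne
      rcases (by omega : i = 0 ∨ i = 1 ∨ i = 2) with rfl | rfl | rfl <;>
        rcases (by omega : i' = 0 ∨ i' = 1 ∨ i' = 2) with rfl | rfl | rfl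
      all_goals first
        | exact absurd rfl hne
        | exact hdis.1
        | exact hdis.2.1
        | exact hdis.2.2
        | exact hdis.1.symm
        | exact hdis.2.1.symm
        | exact hdis.2.2.symm
    have hmp : ∀ i i' : Fin 3, Disjoint ((S i).map (embedElt I.n k r h)) (padSet I.n k r i') :=
      fun i i' => Finset.disjoint_left.2 fun x hx hx' => by
        obtain ⟨y, _, rfl⟩ := Finset.mem_map.1 hx
        exact embedElt_not_mem_padSet h y i' hx'
    exact ⟨⟨h3 i i' hii', (hmp i' i).symm⟩, hmp i i', disjoint_padSet hii'⟩
  have hcov' : ∀ e : Fin (3 * (k * r)), ∃ i, e ∈ padSol h S i := by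
    intro e
    rcases exists_embedElt_or_mem_padSet h e with ⟨x, rfl⟩ | ⟨i, hi⟩
    · have hx : x ∈ S 0 ∪ S 1 ∪ S 2 := hcov ▸ Finset.mem_univ x
      simp only [Finset.mem_union] at hx
      rcases hx with (hx | hx) | hx
      · exact ⟨0, Finset.mem_union_left _ (Finset.mem_map_of_mem _ hx)⟩
      · exact ⟨1, Finset.mem_union_left _ (Finset.mem_map_of_mem _ hx)⟩
      · exact ⟨2, Finset.mem_union_left _ (Finset.mem_map_of_mem _ hx)⟩
    · exact ⟨i, Finset.mem_union_right _ hi⟩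
  unfold solutionLabelling
  rcases (by omega : i = 0 ∨ i = 1 ∨ i = 2) with rfl | rfl | rfl
  · by_cases h0 : e ∈ padSol h S 0
    · simp [h0]
    · by_cases h1 : e ∈ padSol h S 1 <;> simp [h0, h1]
  · by_cases h0 : e ∈ padSol h S 0
    · simp only [h0, if_true, Fin.zero_ne_one, false_iff]
      exact fun h1 => Finset.disjoint_left.1 (hpd (by decide : (0 : Fin 3) ≠ 1)) h0 h1
    · by_cases h1 : e ∈ padSol h S 1 <;> simp [h0, h1]
  · by_cases h0 : e ∈ padSol h S 0
    · simp only [h0, if_true, false_iff, show (0 : Fin 3) ≠ 2 by decide]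
      exact fun h2 => Finset.disjoint_left.1 (hpd (by decide : (0 : Fin 3) ≠ 2)) h0 h2
    · by_cases h1 : e ∈ padSol h S 1
      · simp only [h0, h1, if_false, if_true, false_iff, show (1 : Fin 3) ≠ 2 by decide]
        exact fun h2 => Finset.disjoint_left.1 (hpd (by decide : (1 : Fin 3) ≠ 2)) h1 h2
      · simp only [h0, h1, if_false, true_iff]
        obtain ⟨j, hj⟩ := hcov' e
        rcases (by omega : j = 0 ∨ j = 1 ∨ j = 2) with rfl | rfl | rfl
        · exact absurd hj h0
        · exact absurd hj h1
        · exact hj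

/-- The padded solution sets have `kr` elements each (for `n`-sets `S_i`). [folklore] -/
theorem card_padSol (hcard : ∀ i, (S i).card = I.n) (i : Fin 3) : #(padSol h S i) = k * r := by
  rw [padSol, Finset.card_union_of_disjoint, Finset.card_map, hcard i, card_padSet h]
  · omega
  · exact Finset.disjoint_left.2 fun x hx hx' => by
      obtain ⟨y, _, rfl⟩ := Finset.mem_map.1 hx
      exact embedElt_not_mem_padSet h y i hx'

/-- **The solution's labelling has profile `(kr, kr, kr)`** (so instalment 3b applies to it).
[cite: Pratt2024SCC, §2 (proof of Thm. 1.9)] -/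
theorem solutionLabelling_mem_profileLabellings
    (hdis : Disjoint (S 0) (S 1) ∧ Disjoint (S 0) (S 2) ∧ Disjoint (S 1) (S 2))
    (hcov : S 0 ∪ S 1 ∪ S 2 = Finset.univ) (hcard : ∀ i, (S i).card = I.n) :
    solutionLabelling h S ∈ profileLabellings (Fin (3 * (k * r))) (k * r) := by
  classical
  rw [mem_profileLabellings]
  intro i
  calc #{u | solutionLabelling h S u = i} = #(padSol h S i) := by
        congr 1; ext e
        simp only [Finset.mem_filter, Finset.mem_univ, true_and]
        exact solutionLabelling_eq_iff hdis hcov e i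
    _ = k * r := card_padSol hcard i

/-- **YES instances are accepted when the relabelled solution is block-balanced**: if
`(S₀,S₁,S₂)` is a solution of `I` and the labelling of its padding, read through the permutation
`a`, is block-balanced, then `relabelledCount I h a ≥ 1` (the blockwise parts of the relabelled
solution index a term equal to `1`, and all terms are `≥ 0`). [cite: Pratt2024SCC, §2 (proof of Thm. 1.9)] -/
theorem one_le_relabelledCount (hS : ∀ i, S i ∈ I.F i)
    (hcov : S 0 ∪ S 1 ∪ S 2 = Finset.univ) (a : Equiv.Perm (Fin (3 * (k * r))))
    (hbal : IsBlockBalanced k r (blockEquiv k r).symm (solutionLabelling h S ∘ a)) :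
    1 ≤ relabelledCount I h a := by
  classical
  have hdis : Disjoint (S 0) (S 1) ∧ Disjoint (S 0) (S 2) ∧ Disjoint (S 1) (S 2) :=
    (TripartitionIndex.disjoint_iff_union_eq_univ (k := I.n) ⟨S 0, I.card_eq 0 _ (hS 0)⟩
      ⟨S 1, I.card_eq 1 _ (hS 1)⟩ ⟨S 2, I.card_eq 2 _ (hS 2)⟩).2 hcov
  -- the blockwise parts of the relabelled solution
  let d : Fin 3 → Fin r → TripartitionIndex k := fun i b =>
    ⟨Finset.univ.filter fun t : Fin (3 * k) => solutionLabelling h S (a (blockEquiv k r (b, t))) = i,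
      by have := hbal b i; simpa using this⟩
  -- their relabelled block unions are the padded solution sets
  have hunion : ∀ i, (blockUnion (d i)).1.image a = padSol h S i := by
    intro i
    ext y
    simp only [Finset.mem_image]
    constructor
    · rintro ⟨e, he, rfl⟩
      rw [mem_blockUnion_iff] at he
      simp only [d, Finset.mem_filter, Finset.mem_univ, true_and, Prod.mk.eta,
        Equiv.apply_symm_apply] at he
      exact (solutionLabelling_eq_iff hdis hcov _ i).1 he
    · intro hy
      refine ⟨a.symm y, ?_, by simp⟩
      rw [mem_blockUnion_iff]
      simp only [d, Finset.mem_filter, Finset.mem_univ, true_and, Prod.mk.eta,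
        Equiv.apply_symm_apply]
      exact (solutionLabelling_eq_iff hdis hcov y i).2 hy
  have hind : ∀ i, indicator I h i a (d i) = 1 := by
    intro i
    unfold indicator
    rw [if_pos]
    rw [hunion i, mem_padFamily]
    exact ⟨S i, hS i, rfl⟩
  -- the three parts are blockwise pairwise disjoint (distinct labels)
  have hdis_d : ∀ (b : Fin r) (i i' : Fin 3), i ≠ i' → Disjoint (d i b).1 (d i' b).1 := by
    intro b i i' hne
    rw [Finset.disjoint_left]
    intro t ht ht'
    simp only [d, Finset.mem_filter, Finset.mem_univ, true_and] at ht ht'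
    exact hne (ht.symm.trans ht')
  have hT : kroneckerPow (tripartitionTensor ℤ k) r (d 0) (d 1) (d 2) = 1 := by
    rw [kroneckerPow_apply]
    exact Finset.prod_eq_one fun b _ => tripartitionTensor_apply_of_disjoint ℤ k
      (hdis_d b 0 1 (by decide)) (hdis_d b 0 2 (by decide)) (hdis_d b 1 2 (by decide))
  -- single out that term
  unfold relabelledCount
  calc (1 : ℤ) = kroneckerPow (tripartitionTensor ℤ k) r (d 0) (d 1) (d 2) *
        (indicator I h 0 a (d 0) * indicator I h 1 a (d 1) * indicator I h 2 a (d 2)) := by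
        rw [hT, hind 0, hind 1, hind 2]; norm_num
    _ ≤ ∑ d₂ : Fin r → TripartitionIndex k, kroneckerPow (tripartitionTensor ℤ k) r (d 0) (d 1) d₂ *
        (indicator I h 0 a (d 0) * indicator I h 1 a (d 1) * indicator I h 2 a d₂) :=
        Finset.single_le_sum (f := fun d₂ => kroneckerPow (tripartitionTensor ℤ k) r (d 0) (d 1) d₂ *
          (indicator I h 0 a (d 0) * indicator I h 1 a (d 1) * indicator I h 2 a d₂))
          (fun d₂ _ => term_nonneg (I := I) (h := h) a _ _ _) (Finset.mem_univ (d 2))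
    _ ≤ ∑ d₁ : Fin r → TripartitionIndex k, ∑ d₂ : Fin r → TripartitionIndex k,
        kroneckerPow (tripartitionTensor ℤ k) r (d 0) d₁ d₂ *
          (indicator I h 0 a (d 0) * indicator I h 1 a d₁ * indicator I h 2 a d₂) :=
        Finset.single_le_sum (f := fun d₁ => ∑ d₂ : Fin r → TripartitionIndex k,
          kroneckerPow (tripartitionTensor ℤ k) r (d 0) d₁ d₂ *
            (indicator I h 0 a (d 0) * indicator I h 1 a d₁ * indicator I h 2 a d₂))
          (fun d₁ _ => Finset.sum_nonneg fun d₂ _ => term_nonneg (I := I) (h := h) a _ _ _)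
          (Finset.mem_univ (d 1))
    _ ≤ _ :=
        Finset.single_le_sum (f := fun d₀ => ∑ d₁ : Fin r → TripartitionIndex k,
          ∑ d₂ : Fin r → TripartitionIndex k, kroneckerPow (tripartitionTensor ℤ k) r d₀ d₁ d₂ *
            (indicator I h 0 a d₀ * indicator I h 1 a d₁ * indicator I h 2 a d₂))
          (fun d₀ _ => Finset.sum_nonneg fun d₁ _ => Finset.sum_nonneg fun d₂ _ =>
            term_nonneg (I := I) (h := h) a _ _ _) (Finset.mem_univ (d 0))

end Solution

end Literature.Computability.AlgebraicComplexity
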